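import Mathlib
import Summits.ResolutionOfSingularities.ResolutionOfSingularities.Theorems.WildQuotientsWildQuotientResolutionThird112Defs
import Summits.ResolutionOfSingularities.ResolutionOfSingularities.Theorems.WildQuotientsWildQuotientResolutionHalf111Defs

/-!
# V4U cone bricks, cone side (1): the vertex ideals of `⅓(1,1,2) × 𝔸` and `½(1,1,1) × 𝔸` are prime

(crux stmt-ResolutionOfSingularities-15640 `WildQuotients.WildQuotientResolution`, line `Sketch`,
sector `|G| = p`; programme V4U of `L/w45c/CHAIN.md` v7.1 §4, RULING v7.1 — the ingredient lists of
the two CONE BRICKS `HP₀` (`μ₃`) / `HP₁` (`μ₂`) of `JordanFour.jordanFour_hasResolution_of_bricks`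
(lead-1 p501160), cone side (stub-4 ownership: the cones `Third112.*` / `Half111.*` and their
blow-ups). [OURS · L1 W4.5c] — NOT a statement of any manuscript; replaces the role of no printed
item. Prover res-L1-w45c-stub-4.)

What the consumer (`BlowupExit.exists_isBlowup_regular_of_iso_spec_of_ringEquiv`, p489276, with
`BlowupExit.vanishingIdeal_eq_idealSheaf_of_isRadical`, p485627) needs from the cone side besides
the chart regularity `Third112.blowup_regular` (p498815) / `Half111.blowup_regular` (p500272):

* `Third112.span_gens_isPrime`, `Half111.span_gens_isPrime` — in the presented cone ring
  `k[Y] ⧸ ker (presentation)` the ideal `𝔪` of the generator classes (the centre of the exit blow-up,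
  the reduced singular line `vertex × 𝔸`) is PRIME (so radical): it is the kernel of the passenger
  projection onto the polynomial ring `k[passengers]`, computed through the generic
  `ker_killCompl_eq_span` (`ker (killCompl hf) = (X '' (range f)ᶜ)`).

The companion file `…Half111BlowupAway` adds the regularity of the LOCALISED blow-up
`Bl_{𝔪₂}((½(1,1,1) × 𝔸)[1/q])` (blow-ups commute with flat base change).
-/

-- single-problem summit: the doubled namespace component `ResolutionOfSingularities` is forced
set_option linter.dupNamespace false

noncomputable section

open MvPolynomial

namespace Summit.ResolutionOfSingularities.ResolutionOfSingularities.Theorems.WildQuotientResolution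

/-! ## Generic: the kernel of `killCompl` is the ideal of the killed variables -/

namespace ConeVertex

/-- `p − rename f (killCompl hf p)` lies in the ideal of the variables outside `range f`.
[folklore] -/
theorem sub_rename_killCompl_mem_span {σ τ R : Type*} [CommRing R] {f : σ → τ}
    (hf : Function.Injective f) (p : MvPolynomial τ R) :
    p - rename f (killCompl hf p) ∈ Ideal.span (X '' (Set.range f)ᶜ : Set (MvPolynomial τ R)) := by
  classical
  induction p using MvPolynomial.induction_on with
  | C r => simp
  | add p q hp hq =>
    have : p + q - rename f (killCompl hf (p + q)) =
        (p - rename f (killCompl hf p)) + (q - rename f (killCompl hf q)) := by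
      simp only [map_add]; ring
    rw [this]
    exact Ideal.add_mem _ hp hq
  | mul_X p i hp =>
    by_cases hi : i ∈ Set.range f
    · obtain ⟨j, rfl⟩ := hi
      have hX : killCompl hf (X (f j) : MvPolynomial τ R) = X j := by
        simpa using killCompl_rename_app hf (X j : MvPolynomial σ R)
      have : p * X (f j) - rename f (killCompl hf (p * X (f j))) =
          (p - rename f (killCompl hf p)) * X (f j) := by
        rw [map_mul, hX, map_mul, rename_X]; ring
      rw [this]
      exact Ideal.mul_mem_right _ _ hp
    · have hX : killCompl hf (X i : MvPolynomial τ R) = 0 := by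
        simp only [killCompl, aeval_X, dif_neg hi]
      rw [map_mul, hX, mul_zero, map_zero, sub_zero]
      exact Ideal.mul_mem_left _ _ (Ideal.subset_span ⟨i, hi, rfl⟩)

/-- **`ker (killCompl hf) = (X i : i ∉ range f)`**: killing the variables outside the range of an
injective `f : σ → τ` has kernel exactly the ideal they generate. [folklore] -/
theorem ker_killCompl_eq_span {σ τ R : Type*} [CommRing R] {f : σ → τ}
    (hf : Function.Injective f) :
    RingHom.ker (killCompl (R := R) hf).toRingHom =
      Ideal.span (X '' (Set.range f)ᶜ : Set (MvPolynomial τ R)) := by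
  classical
  apply le_antisymm
  · intro p hp
    rw [RingHom.mem_ker] at hp
    have h := sub_rename_killCompl_mem_span hf p
    have hp' : killCompl hf p = 0 := hp
    rwa [hp', map_zero, sub_zero] at h
  · rw [Ideal.span_le]
    rintro _ ⟨i, hi, rfl⟩
    change killCompl hf (X i : MvPolynomial τ R) = 0
    simp only [killCompl, aeval_X, dif_neg hi]

/-- The ideal of the variables outside the range of an injective `f : σ → τ` is prime (the quotient
is the polynomial ring on `σ`). [folklore] -/
theorem isPrime_span_X_image_compl_range {σ τ R : Type*} [CommRing R] [IsDomain R] {f : σ → τ}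
    (hf : Function.Injective f) :
    (Ideal.span (X '' (Set.range f)ᶜ : Set (MvPolynomial τ R))).IsPrime := by
  rw [← ker_killCompl_eq_span hf]
  exact RingHom.ker_isPrime _

/-- **Primality of a generator ideal in a presented ring.** Let `π : k[Y] → B` be a ring map (a
presentation, `A = k[Y] ⧸ ker π`), `θ : k[Y] → D` a ring map to a domain with `ker π ≤ ker θ` whose
kernel is generated by a set `G ⊆ k[Y]`. Then the ideal of `A` generated by the classes of `G` is
prime: it is the kernel of the induced map `A → D`. [folklore] -/
theorem isPrime_span_image_mk_of_ker_eq {P B D : Type*} [CommRing P] [CommRing B] [CommRing D]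
    [IsDomain D] (π : P →+* B) (θ : P →+* D) (hle : RingHom.ker π ≤ RingHom.ker θ) (G : Set P)
    (hG : RingHom.ker θ = Ideal.span G) :
    (Ideal.span (Ideal.Quotient.mk (RingHom.ker π) '' G)).IsPrime := by
  have hker : RingHom.ker (Ideal.Quotient.lift (RingHom.ker π) θ fun a ha => hle ha) =
      Ideal.span (Ideal.Quotient.mk (RingHom.ker π) '' G) := by
    rw [Ideal.ker_quotient_lift, hG, Ideal.map_span]
  rw [← hker]
  exact RingHom.ker_isPrime _

end ConeVertex

/-! ## The `⅓(1,1,2)` cone: the vertex ideal is prime -/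

namespace Third112

variable (k : Type) [Field k] (n : ℕ) (a b c : Fin n)

/-- The passenger projection `k[Y] → k[{i // i ≠ a, b, c}]` (`Y = Fin n ⊕ Fin 4`): `inl i ↦ X i` for a
passenger, every other symbol `↦ 0`; it is `killCompl` for the embedding `i ↦ inl i`. [folklore] -/
theorem passenger_injective :
    Function.Injective (fun i : {i : Fin n // i ≠ a ∧ i ≠ b ∧ i ≠ c} =>
      (Sum.inl i.1 : Fin n ⊕ Fin 4)) := by
  intro i j h
  exact Subtype.ext (Sum.inl_injective h)

/-- The symbols killed by the passenger projection are exactly the seven generator symbols.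
[folklore] -/
theorem compl_range_passenger_eq :
    (Set.range (fun i : {i : Fin n // i ≠ a ∧ i ≠ b ∧ i ≠ c} =>
      (Sum.inl i.1 : Fin n ⊕ Fin 4)))ᶜ =
      {Sum.inl a, Sum.inl b, Sum.inl c, Sum.inr 0, Sum.inr 1, Sum.inr 2, Sum.inr 3} := by
  ext y
  simp only [Set.mem_compl_iff, Set.mem_range, not_exists, Set.mem_insert_iff,
    Set.mem_singleton_iff]
  constructor
  · intro h
    rcases y with i | j
    · by_cases hia : i = a
      · exact Or.inl (by rw [hia])
      by_cases hib : i = b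
      · exact Or.inr (Or.inl (by rw [hib]))
      by_cases hic : i = c
      · exact Or.inr (Or.inr (Or.inl (by rw [hic])))
      exact absurd rfl (h ⟨i, hia, hib, hic⟩)
    · right; right; right
      fin_cases j <;> simp
  · rintro (h | h | h | h | h | h | h) ⟨i, hia, hib, hic⟩ hy <;>
      simp_all [Sum.inl.injEq]

/-- `X '' {the seven symbols} = range gens`. [folklore] -/
theorem X_image_eq_range_gens :
    (X '' ({Sum.inl a, Sum.inl b, Sum.inl c, Sum.inr 0, Sum.inr 1, Sum.inr 2, Sum.inr 3} :
        Set (Fin n ⊕ Fin 4)) : Set (MvPolynomial (Fin n ⊕ Fin 4) k)) =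
      Set.range (gens k n a b c) := by
  ext F
  simp only [Set.mem_image, Set.mem_insert_iff, Set.mem_singleton_iff, Set.mem_range, gens]
  constructor
  · rintro ⟨y, hy, rfl⟩
    rcases hy with rfl | rfl | rfl | rfl | rfl | rfl | rfl
    exacts [⟨0, by simp⟩, ⟨1, by simp⟩, ⟨2, by simp⟩, ⟨3, by simp⟩, ⟨4, by simp⟩, ⟨5, by simp⟩,
      ⟨6, by simp⟩]
  · rintro ⟨l, rfl⟩
    fin_cases l
    exacts [⟨Sum.inl a, by simp⟩, ⟨Sum.inl b, by simp⟩, ⟨Sum.inl c, by simp⟩, ⟨Sum.inr 0, by simp⟩,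
      ⟨Sum.inr 1, by simp⟩, ⟨Sum.inr 2, by simp⟩, ⟨Sum.inr 3, by simp⟩]

/-- The passenger projection factors through the presentation: it is `ε ∘ presentation` with
`ε : x_a, x_b, x_c ↦ 0`, passengers `↦` themselves; hence `ker presentation ≤ ker (passenger
projection)`. [folklore] -/
theorem ker_presentation_le_ker_killCompl :
    RingHom.ker (presentation k n a b c).toRingHom ≤
      RingHom.ker (killCompl (R := k) (passenger_injective n a b c)).toRingHom := by
  classical
  -- `ε : k[x] → k[passengers]`
  let ε : MvPolynomial (Fin n) k →ₐ[k] MvPolynomial {i : Fin n // i ≠ a ∧ i ≠ b ∧ i ≠ c} k :=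
    MvPolynomial.aeval fun i =>
      if h : i ≠ a ∧ i ≠ b ∧ i ≠ c then X ⟨i, h⟩ else 0
  have hεa : ε (X a) = 0 := by simp [ε]
  have hεb : ε (X b) = 0 := by simp [ε]
  have hεc : ε (X c) = 0 := by simp [ε]
  have hfac : killCompl (R := k) (passenger_injective n a b c) = ε.comp (presentation k n a b c) := by
    apply MvPolynomial.algHom_ext
    intro y
    rcases y with i | j
    · by_cases hia : i = a
      · subst hia
        rw [AlgHom.comp_apply, presentation_inl_a, map_pow, hεa, zero_pow three_ne_zero]
        simp [killCompl]
      by_cases hib : i = b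
      · subst hib
        rw [AlgHom.comp_apply, presentation_inl_b k n a i c (fun h => hia h.symm), map_pow, hεb,
          zero_pow three_ne_zero]
        simp [killCompl, hia]
      by_cases hic : i = c
      · subst hic
        rw [AlgHom.comp_apply, presentation_inl_c k n a b i (fun h => hia h.symm)
          (fun h => hib h.symm), map_pow, hεc, zero_pow three_ne_zero]
        simp [killCompl, hia, hib]
      · rw [AlgHom.comp_apply, presentation_inl_of_ne k n a b c i hia hib hic]
        have h1 : killCompl (R := k) (passenger_injective n a b c) (X (Sum.inl i)) =
            X ⟨i, hia, hib, hic⟩ := by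
          simpa using killCompl_rename_app (R := k) (passenger_injective n a b c)
            (X ⟨i, hia, hib, hic⟩)
        rw [h1]
        simp [ε, hia, hib, hic]
    · fin_cases j
      · rw [AlgHom.comp_apply]
        simp only [Fin.zero_eta, Fin.isValue, presentation_inr_zero, map_mul, map_pow, hεa, hεb,
          mul_zero]
        simp [killCompl]
      · rw [AlgHom.comp_apply]
        simp only [Fin.mk_one, Fin.isValue, presentation_inr_one, map_mul, map_pow, hεa, hεb,
          zero_mul]
        simp [killCompl]
      · rw [AlgHom.comp_apply]
        simp only [Fin.reduceFinMk, Fin.isValue, presentation_inr_two, map_mul, hεa, hεc,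
          mul_zero]
        simp [killCompl]
      · rw [AlgHom.comp_apply]
        simp only [Fin.reduceFinMk, Fin.isValue, presentation_inr_three, map_mul, hεb, hεc,
          mul_zero]
        simp [killCompl]
  intro F hF
  rw [RingHom.mem_ker] at hF ⊢
  change killCompl (R := k) (passenger_injective n a b c) F = 0
  rw [hfac, AlgHom.comp_apply]
  change presentation k n a b c F = 0 at hF
  rw [hF, map_zero]

/-- **The vertex ideal of the `⅓(1,1,2) × 𝔸` cone is prime**: in `A = k[Y] ⧸ ker (presentation)`
the ideal `𝔪` generated by the seven generator classes — the centre of the exit blow-up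
`Third112.blowup_regular`, the reduced singular line `vertex × 𝔸^{n−3}` — is the kernel of the
passenger projection `A → k[passengers]`, hence prime (and radical). [OURS · L1 W4.5c] [folklore] -/
theorem span_gens_isPrime :
    (Ideal.span (Set.range (fun l : Fin 7 =>
        Ideal.Quotient.mk (RingHom.ker (presentation k n a b c)) (gens k n a b c l)))).IsPrime := by
  have hG := ConeVertex.ker_killCompl_eq_span (R := k) (passenger_injective n a b c)
  rw [compl_range_passenger_eq, X_image_eq_range_gens] at hG
  have h := ConeVertex.isPrime_span_image_mk_of_ker_eq (presentation k n a b c).toRingHom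
    (killCompl (R := k) (passenger_injective n a b c)).toRingHom
    (ker_presentation_le_ker_killCompl k n a b c) (Set.range (gens k n a b c)) hG
  rwa [← Set.range_comp] at h

/-- Hence the vertex ideal is radical (input `hI` of
`BlowupExit.vanishingIdeal_eq_idealSheaf_of_isRadical`). [folklore] -/
theorem span_gens_isRadical :
    (Ideal.span (Set.range (fun l : Fin 7 =>
        Ideal.Quotient.mk (RingHom.ker (presentation k n a b c)) (gens k n a b c l)))).IsRadical :=
  (span_gens_isPrime k n a b c).isRadical

end Third112

/-! ## The `½(1,1,1)` cone: the vertex ideal is prime -/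

namespace Half111

variable (k : Type) [Field k] (n : ℕ) (a b c : Fin n)

/-- The passenger embedding `i ↦ inl i` (`Y = Fin n ⊕ Fin 3`) is injective. [folklore] -/
theorem passenger_injective :
    Function.Injective (fun i : {i : Fin n // i ≠ a ∧ i ≠ b ∧ i ≠ c} =>
      (Sum.inl i.1 : Fin n ⊕ Fin 3)) := by
  intro i j h
  exact Subtype.ext (Sum.inl_injective h)

/-- The symbols killed by the passenger projection are exactly the six generator symbols.
[folklore] -/
theorem compl_range_passenger_eq :
    (Set.range (fun i : {i : Fin n // i ≠ a ∧ i ≠ b ∧ i ≠ c} =>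
      (Sum.inl i.1 : Fin n ⊕ Fin 3)))ᶜ =
      {Sum.inl a, Sum.inl b, Sum.inl c, Sum.inr 0, Sum.inr 1, Sum.inr 2} := by
  ext y
  simp only [Set.mem_compl_iff, Set.mem_range, not_exists, Set.mem_insert_iff,
    Set.mem_singleton_iff]
  constructor
  · intro h
    rcases y with i | j
    · by_cases hia : i = a
      · exact Or.inl (by rw [hia])
      by_cases hib : i = b
      · exact Or.inr (Or.inl (by rw [hib]))
      by_cases hic : i = c
      · exact Or.inr (Or.inr (Or.inl (by rw [hic])))
      exact absurd rfl (h ⟨i, hia, hib, hic⟩)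
    · right; right; right
      fin_cases j <;> simp
  · rintro (h | h | h | h | h | h) ⟨i, hia, hib, hic⟩ hy <;>
      simp_all [Sum.inl.injEq]

/-- `X '' {the six symbols} = range gens`. [folklore] -/
theorem X_image_eq_range_gens :
    (X '' ({Sum.inl a, Sum.inl b, Sum.inl c, Sum.inr 0, Sum.inr 1, Sum.inr 2} :
        Set (Fin n ⊕ Fin 3)) : Set (MvPolynomial (Fin n ⊕ Fin 3) k)) =
      Set.range (gens k n a b c) := by
  ext F
  simp only [Set.mem_image, Set.mem_insert_iff, Set.mem_singleton_iff, Set.mem_range, gens]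
  constructor
  · rintro ⟨y, hy, rfl⟩
    rcases hy with rfl | rfl | rfl | rfl | rfl | rfl
    exacts [⟨0, by simp⟩, ⟨3, by simp⟩, ⟨5, by simp⟩, ⟨1, by simp⟩, ⟨2, by simp⟩, ⟨4, by simp⟩]
  · rintro ⟨l, rfl⟩
    fin_cases l
    exacts [⟨Sum.inl a, by simp⟩, ⟨Sum.inr 0, by simp⟩, ⟨Sum.inr 1, by simp⟩, ⟨Sum.inl b, by simp⟩,
      ⟨Sum.inr 2, by simp⟩, ⟨Sum.inl c, by simp⟩]

/-- The passenger projection factors through the presentation (`ε : x_a, x_b, x_c ↦ 0`), hence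
`ker presentation ≤ ker (passenger projection)`. [folklore] -/
theorem ker_presentation_le_ker_killCompl :
    RingHom.ker (presentation k n a b c).toRingHom ≤
      RingHom.ker (killCompl (R := k) (passenger_injective n a b c)).toRingHom := by
  classical
  let ε : MvPolynomial (Fin n) k →ₐ[k] MvPolynomial {i : Fin n // i ≠ a ∧ i ≠ b ∧ i ≠ c} k :=
    MvPolynomial.aeval fun i =>
      if h : i ≠ a ∧ i ≠ b ∧ i ≠ c then X ⟨i, h⟩ else 0
  have hεa : ε (X a) = 0 := by simp [ε]
  have hεb : ε (X b) = 0 := by simp [ε]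
  have hεc : ε (X c) = 0 := by simp [ε]
  have hfac : killCompl (R := k) (passenger_injective n a b c) = ε.comp (presentation k n a b c) := by
    apply MvPolynomial.algHom_ext
    intro y
    rcases y with i | j
    · by_cases hia : i = a
      · subst hia
        rw [AlgHom.comp_apply, presentation_inl_a, map_pow, hεa, zero_pow two_ne_zero]
        simp [killCompl]
      by_cases hib : i = b
      · subst hib
        rw [AlgHom.comp_apply, presentation_inl_b k n a i c (fun h => hia h.symm), map_pow, hεb,
          zero_pow two_ne_zero]
        simp [killCompl, hia]
      by_cases hic : i = c
      · subst hic
        rw [AlgHom.comp_apply, presentation_inl_c k n a b i (fun h => hia h.symm)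
          (fun h => hib h.symm), map_pow, hεc, zero_pow two_ne_zero]
        simp [killCompl, hia, hib]
      · rw [AlgHom.comp_apply, presentation_inl_of_ne k n a b c i hia hib hic]
        have h1 : killCompl (R := k) (passenger_injective n a b c) (X (Sum.inl i)) =
            X ⟨i, hia, hib, hic⟩ := by
          simpa using killCompl_rename_app (R := k) (passenger_injective n a b c)
            (X ⟨i, hia, hib, hic⟩)
        rw [h1]
        simp [ε, hia, hib, hic]
    · fin_cases j
      · rw [AlgHom.comp_apply]
        simp only [Fin.zero_eta, Fin.isValue, presentation_inr_zero, map_mul, hεa, hεb, mul_zero]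
        simp [killCompl]
      · rw [AlgHom.comp_apply]
        simp only [Fin.mk_one, Fin.isValue, presentation_inr_one, map_mul, hεa, hεc, mul_zero]
        simp [killCompl]
      · rw [AlgHom.comp_apply]
        simp only [Fin.reduceFinMk, Fin.isValue, presentation_inr_two, map_mul, hεb, hεc, mul_zero]
        simp [killCompl]
  intro F hF
  rw [RingHom.mem_ker] at hF ⊢
  change killCompl (R := k) (passenger_injective n a b c) F = 0
  rw [hfac, AlgHom.comp_apply]
  change presentation k n a b c F = 0 at hF
  rw [hF, map_zero]

/-- **The vertex ideal of the `½(1,1,1) × 𝔸` cone is prime**: in `A = k[Y] ⧸ ker (presentation)`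
the ideal `𝔪₂` generated by the six generator classes — the centre of the exit blow-up
`Half111.blowup_regular`, the reduced singular line — is the kernel of the passenger projection
`A → k[passengers]`, hence prime (and radical). [OURS · L1 W4.5c] [folklore] -/
theorem span_gens_isPrime :
    (Ideal.span (Set.range (fun l : Fin 6 =>
        Ideal.Quotient.mk (RingHom.ker (presentation k n a b c)) (gens k n a b c l)))).IsPrime := by
  have hG := ConeVertex.ker_killCompl_eq_span (R := k) (passenger_injective n a b c)
  rw [compl_range_passenger_eq, X_image_eq_range_gens] at hG
  have h := ConeVertex.isPrime_span_image_mk_of_ker_eq (presentation k n a b c).toRingHom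
    (killCompl (R := k) (passenger_injective n a b c)).toRingHom
    (ker_presentation_le_ker_killCompl k n a b c) (Set.range (gens k n a b c)) hG
  rwa [← Set.range_comp] at h

/-- Hence the vertex ideal is radical. [folklore] -/
theorem span_gens_isRadical :
    (Ideal.span (Set.range (fun l : Fin 6 =>
        Ideal.Quotient.mk (RingHom.ker (presentation k n a b c)) (gens k n a b c l)))).IsRadical :=
  (span_gens_isPrime k n a b c).isRadical

end Half111

end Summit.ResolutionOfSingularities.ResolutionOfSingularities.Theorems.WildQuotientResolution

end
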